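import Literature.NumberTheory.Connes2026.SeparatedSincExpansion
import Literature.NumberTheory.Connes2026.AnnulusOffShellReduction
import Literature.NumberTheory.Connes2026.EvenPartProjection
import Literature.NumberTheory.Connes2026.ScalingOpTranslation
import Literature.Analysis.OperatorTheory.NuclearDiagonalCompression
import Mathlib.Analysis.Normed.Group.Tannery
import HarnessLib

/-!
# Connes 1999 Thm VII.4, `k = ℚ`, `S = {∞, p}`: the SEPARATED sinc remainder has a uniformly bounded,
# basis-free trace on `L²(ℝ)_ev` tending to `0` — (S1), (S0), (S2) — hence the semilocal trace formula at
# `P = {p}` is a THEOREM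

LABEL (line 1): RH-FREE literature (theorems only; NO definition, NO named fact).  bears_on: LADDER-RH
W-C/W-P (C1 named-fact debt), cell `rh-crit`, sub-cell cc, overflow row O1 — the last step of the "annulus
road" at ONE prime under `Connes1999_thm_VII_4_rat`: the entry point
`Connes1999_thm_VII_4_rat_singleton_of_separated` (seat gm-t13 g5) fed with (S1), (S0), (S2).  WHAT THIS IS
NOT: a discharge of the fact for general `P`; any claim about positivity, Weil's criterion or RH — Connes's
semilocal trace formula is an RH-free asymptotic statement about cutoffs.

Sources.  A. Connes, Selecta Math. 5 (1999) [`Connes1999`], §VII Thm 4 and its proof (29)–(33) (held text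
`paper:arxiv-math_9811068`, p0013); M. Reed, B. Simon I (1972) [`ReedSimon1972`], Thm. VI.18, VI.24.

## The argument

By `exists_rankOne_expansion_separatedSinc`, `T_M := (1 − Q̃) P̂⁰_M Q₀ = Σ_k λ_k |u_k^M⟩⟨w_k^M|` with
`Σ_k |λ_k| (‖u_k‖² + ‖w_k‖²) = C₀ < ∞` independent of `M`, the vectors being modulations `e^{2πiσ_kM·}` of fixed
`L²` functions.  For `X = ϑ(g)`, `Y = ϑ(e^{m log p})` and a Hilbert basis `(f_i)` of `L²(ℝ)_ev`,
`rankOne_sandwich_diag_coe` gives: `Σ_i |⟨f_i, X T_M Y f_i⟩| ≤ (‖X‖² + 1) C₀` (S1) and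
`Σ_i ⟨f_i, X T_M Y f_i⟩ = Σ_k λ_k ⟨Y^* w_k^M, P_ev X u_k^M⟩` — basis free (S0).  With `P_ev = ½(1 + R)`,
`Y ϑ(g) = ϑ(g(· − m log p))` and `R ϑ = ϑ R`, each term is `½⟨w_k^M, ϑ(g_m) u_k^M⟩ + ½⟨w_k^M, ϑ(g_m) R u_k^M⟩ → 0`
by the Riemann–Lebesgue lemma for `ϑ` (`tendsto_inner_scalingOp_modulated`; frequencies `σ_k`, `±σ_k ≠ 0`),
and Tannery's theorem gives (S2).  For `M ≤ 0`, `P̂⁰_M = 0`.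

## What is proved

* `cutoffProj_of_nonpos`, `dualCutoffProj_empty_of_nonpos` (`P_M = 0 = P̂⁰_M` for `M ≤ 0`);
  `commute_reflectL2_scalingUnitary`, `commute_reflectL2_scalingOp` (`R ϑ = ϑ R`); `norm_scalingUnitary_le_one`;
* `tendsto_inner_adjoint_starProjection_scalingOp` — the term limit;
* **`separatedRemainder_bound_indep_tendsto`** — (S1) ∧ (S0) ∧ (S2) for every Weil test function and `δ > 0`;
* **`Connes1999_thm_VII_4_rat_singleton`** — the conclusion of `Connes1999_thm_VII_4_rat` at `P = {p}`,
  for every prime `p`, every Weil test function and every Hilbert basis of `L²(ℝ)_ev` (no hypotheses left).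

No instance, notation or attribute; no `def`.
-/

noncomputable section

open _root_.MeasureTheory Complex Set Filter Function
open scoped Real Topology ComplexConjugate InnerProductSpace

namespace Literature.NumberTheory.Connes2026

open Literature.NumberTheory.LFunctions Literature.Analysis.OperatorTheory
open Literature.NumberTheory.ConnesConsani
open Literature.NumberTheory.ConnesConsani2024
open Literature.NumberTheory.ConnesConsani2021 hiding cutoffProj cutoffProj_coeFn

/-! ## §1. Plumbing: `P_M = 0` for `M ≤ 0`; `R` commutes with `ϑ`; `‖ϑ(e^τ)‖ ≤ 1` -/

/-- `P_Λ = 0` for `Λ ≤ 0` (`[−Λ, Λ]` is empty or a point). [cite: Connes1999, §VII eq. (12) (arXiv p0013)] -/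
theorem cutoffProj_of_nonpos {Λ : ℝ} (hΛ : Λ ≤ 0) :
    cutoffProj Λ = (0 : Lp ℂ 2 (volume : Measure ℝ) →L[ℂ] Lp ℂ 2 (volume : Measure ℝ)) := by
  refine ContinuousLinearMap.ext fun ξ => Lp.ext ?_
  have hvol : (volume : Measure ℝ) (Set.Icc (-Λ) Λ) = 0 := by
    rw [Real.volume_Icc]; exact ENNReal.ofReal_of_nonpos (by linarith)
  filter_upwards [cutoffProj_coeFn Λ ξ, measure_eq_zero_iff_ae_notMem.mp hvol,
    Lp.coeFn_zero ℂ 2 (volume : Measure ℝ)] with x h1 hx h0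
  rw [h1, Set.indicator_of_notMem hx, zero_apply, h0, Pi.zero_apply]

/-- `P̂⁰_M = 𝓕 P_M 𝓕⁻¹ = 0` for `M ≤ 0`. [cite: Connes1999, §VII eq. (13) (arXiv p0013)] -/
theorem dualCutoffProj_empty_of_nonpos {M : ℝ} (hM : M ≤ 0) : dualCutoffProj ∅ M = 0 := by
  rw [dualCutoffProj_empty, cutoffProj_of_nonpos hM, mul_zero, zero_mul]

/-- The reflection commutes with every dilation: `R ϑ(e^τ) = ϑ(e^τ) R`. [cite: ConnesConsani2021, §4 eq. (40) p. 15] -/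
theorem commute_reflectL2_scalingUnitary (τ : ℝ) : Commute reflectL2 (scalingUnitary τ) := by
  change reflectL2 * scalingUnitary τ = scalingUnitary τ * reflectL2
  refine ContinuousLinearMap.ext fun η => Lp.ext ?_
  change ((reflectL2 (scalingUnitary τ η) : Lp ℂ 2 (volume : Measure ℝ)) : ℝ → ℂ) =ᵐ[volume]
    ((scalingUnitary τ (reflectL2 η) : Lp ℂ 2 (volume : Measure ℝ)) : ℝ → ℂ)
  have h1 := reflectL2_coeFn (scalingUnitary τ η)
  have h2 := (Measure.measurePreserving_neg (volume : Measure ℝ)).quasiMeasurePreserving.ae_eq_comp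
    (scalingUnitary_coeFn τ η)
  have h3 := scalingUnitary_coeFn τ (reflectL2 η)
  have h4 := ae_eq_comp_smul (V := ℝ) (reflectL2_coeFn η) (Real.exp_pos (-τ)).ne'
  filter_upwards [h1, h2, h3, h4] with x e1 e2 e3 e4
  have e2' : (scalingUnitary τ η : ℝ → ℂ) (-x) = (Real.exp (-τ / 2) : ℂ) * (η : ℝ → ℂ) (Real.exp (-τ) * -x) := e2
  have e4' : (reflectL2 η : ℝ → ℂ) (Real.exp (-τ) * x) = (η : ℝ → ℂ) (-(Real.exp (-τ) * x)) := by
    simpa only [smul_eq_mul] using e4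
  rw [e1, e2', e3, e4', mul_neg]

/-- The reflection commutes with the integrated operator: `R ϑ(g) = ϑ(g) R`. [cite: ConnesConsani2021, Prop. 2.2 (iii) p. 10] -/
theorem commute_reflectL2_scalingOp (g : ℝ → ℂ) : Commute reflectL2 (scalingOp g) :=
  commute_scalingOp_of_forall_commute_scalingUnitary g commute_reflectL2_scalingUnitary

/-- `‖ϑ(e^τ)‖ ≤ 1`. [cite: ConnesConsani2021, §4 eq. (40) p. 15] -/
theorem norm_scalingUnitary_le_one (τ : ℝ) : ‖scalingUnitary τ‖ ≤ 1 :=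
  ContinuousLinearMap.opNorm_le_bound _ zero_le_one fun x => by rw [norm_scalingUnitary_apply, one_mul]

/-! ## §2. The term limit: `⟨ϑ(e^c)^* w^M, P_ev ϑ(g) u^M⟩ → 0` for modulated `u^M`, `w^M` -/

/-- **Each term of the trace tends to `0`.**  For `g ∈ L¹`, `c ∈ ℝ`, `ψ, φ ∈ L²(ℝ)`, a frequency `a ≠ 0` and
families `Ψ_M =ᵐ e^{2πiaM·}ψ`, `Φ_M =ᵐ e^{2πiaM·}φ`:
`⟨ϑ(e^c)^* Ψ_M, P_ev ϑ(g) Φ_M⟩ = ½⟨Ψ_M, ϑ(g(·−c)) Φ_M⟩ + ½⟨Ψ_M, ϑ(g(·−c)) R Φ_M⟩ → 0` (`P_ev = ½(1+R)`,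
`ϑ(e^c)ϑ(g) = ϑ(g(· − c))`, `Rϑ = ϑR`, and Riemann–Lebesgue for `ϑ` with frequencies `(a, a)` and `(a, −a)`). [cite: Connes1999, §VII proof of Thm 4 eqs. (29)–(33) (arXiv p0013); ConnesConsani2021, Prop. 2.2 (iii) p. 10] -/
theorem tendsto_inner_adjoint_starProjection_scalingOp [evenPart.HasOrthogonalProjection]
    {g : ℝ → ℂ} (hg : Integrable g) (c : ℝ)
    {ψ φ : ℝ → ℂ} (hψ : MemLp ψ 2 (volume : Measure ℝ)) (hφ : MemLp φ 2 (volume : Measure ℝ))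
    {a : ℝ} (ha : a ≠ 0) {Ψ Φ : ℝ → Lp ℂ 2 (volume : Measure ℝ)}
    (hΨ : ∀ M, (Ψ M : ℝ → ℂ) =ᵐ[volume] fun x => cexp (2 * π * I * ((a * M * x : ℝ) : ℂ)) * ψ x)
    (hΦ : ∀ M, (Φ M : ℝ → ℂ) =ᵐ[volume] fun x => cexp (2 * π * I * ((a * M * x : ℝ) : ℂ)) * φ x) :
    Tendsto (fun M : ℝ => ⟪ContinuousLinearMap.adjoint (scalingUnitary c) (Ψ M),
        (evenPart : Submodule ℂ (Lp ℂ 2 (volume : Measure ℝ))).starProjection (scalingOp g (Φ M))⟫_ℂ)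
      atTop (𝓝 0) := by
  have hgc : Integrable (fun τ => g (τ - c)) := hg.comp_sub_right c
  -- the reflected family
  have hφ' : MemLp (fun x => φ (-x)) 2 (volume : Measure ℝ) :=
    hφ.comp_measurePreserving (Measure.measurePreserving_neg (volume : Measure ℝ))
  have hRΦ : ∀ M, (reflectL2 (Φ M) : ℝ → ℂ) =ᵐ[volume]
      fun x => cexp (2 * π * I * ((-a * M * x : ℝ) : ℂ)) * φ (-x) := by
    intro M
    have h2 := (Measure.measurePreserving_neg (volume : Measure ℝ)).quasiMeasurePreserving.ae_eq_comp (hΦ M)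
    filter_upwards [reflectL2_coeFn (Φ M), h2] with x h1 hx
    have hx' : (Φ M : ℝ → ℂ) (-x) = cexp (2 * π * I * ((a * M * -x : ℝ) : ℂ)) * φ (-x) := hx
    rw [h1, hx', show a * M * -x = -a * M * x by ring]
  -- rewrite the term
  have hrew : ∀ M, ⟪ContinuousLinearMap.adjoint (scalingUnitary c) (Ψ M),
      (evenPart : Submodule ℂ (Lp ℂ 2 (volume : Measure ℝ))).starProjection (scalingOp g (Φ M))⟫_ℂ =
      (2 : ℂ)⁻¹ * ⟪Ψ M, scalingOp (fun τ => g (τ - c)) (Φ M)⟫_ℂ +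
        (2 : ℂ)⁻¹ * ⟪Ψ M, scalingOp (fun τ => g (τ - c)) (reflectL2 (Φ M))⟫_ℂ := by
    intro M
    rw [starProjection_evenPart_eq, inner_smul_right, inner_add_right, ContinuousLinearMap.adjoint_inner_left,
      ContinuousLinearMap.adjoint_inner_left]
    have h1 : scalingUnitary c (scalingOp g (Φ M)) = scalingOp (fun τ => g (τ - c)) (Φ M) := by
      rw [← ContinuousLinearMap.comp_apply, scalingUnitary_comp_scalingOp hg]
    have h2 : scalingUnitary c (reflectL2 (scalingOp g (Φ M))) = scalingOp (fun τ => g (τ - c)) (reflectL2 (Φ M)) := by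
      have hc := (commute_reflectL2_scalingOp g).eq
      have hc' : reflectL2 (scalingOp g (Φ M)) = scalingOp g (reflectL2 (Φ M)) := by
        change (reflectL2 * scalingOp g) (Φ M) = (scalingOp g * reflectL2) (Φ M)
        rw [hc]
      rw [hc', ← ContinuousLinearMap.comp_apply, scalingUnitary_comp_scalingOp hg]
    rw [h1, h2]
    ring
  simp_rw [hrew]
  have h1 := tendsto_inner_scalingOp_modulated hψ hφ hgc (a := a) (b := a) ha hΨ hΦ
  have h2 := tendsto_inner_scalingOp_modulated hψ hφ' hgc (a := a) (b := -a) (neg_ne_zero.mpr ha) hΨ hRΦ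
  have h := (h1.const_mul (2 : ℂ)⁻¹).add (h2.const_mul (2 : ℂ)⁻¹)
  simpa only [mul_zero, add_zero] using h

variable (p : ℕ) [hp : Fact p.Prime]

/-! ## §3. (S1), (S0), (S2) for the separated remainder -/

/-- **The separated remainder: uniform bound (S1), basis independence (S0), vanishing limit (S2).**  For a Weil
test function `g`, a prime `p` and `δ > 0`, with `Q₀ = Q_{1/p,1}`, `Q̃ = Q_{e^{−δ}/p, e^δ}`: the diagonal series of
`ϑ(g)(1 − Q̃)P̂⁰_MQ₀ϑ_{m log p}` along Hilbert bases of `L²(ℝ)_ev` are absolutely summable with sums bounded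
uniformly in `(M, m, basis)`, independent of the basis, and tend to `0` as `M → ∞`. [cite: Connes1999, §VII Thm 4 and proof eqs. (29)–(33) (arXiv p0013); ReedSimon1972, Thm. VI.18 and VI.24, PDF pp. 196–199] -/
theorem separatedRemainder_bound_indep_tendsto {g : ℝ → ℂ} (hg : IsWeilTest g) {δ : ℝ} (hδ : 0 < δ) :
    ∃ C : ℝ,
    (∀ (M : ℝ) (m : ℤ) (ι : Type) (f : HilbertBasis ι ℂ (evenPart : Submodule ℂ (Lp ℂ 2 (volume : Measure ℝ)))),
      Summable (fun i => ‖⟪((f i : evenPart) : Lp ℂ 2 (volume : Measure ℝ)),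
        (scalingOp g ∘L ((1 - shellProj ((p : ℝ)⁻¹ * Real.exp (-δ)) (Real.exp δ)) ∘L
          (dualCutoffProj ∅ M ∘L (annulusProj p 1 ∘L scalingUnitary (m * Real.log p)))))
          ((f i : evenPart) : Lp ℂ 2 (volume : Measure ℝ))⟫_ℂ‖) ∧
      ∑' i, ‖⟪((f i : evenPart) : Lp ℂ 2 (volume : Measure ℝ)),
        (scalingOp g ∘L ((1 - shellProj ((p : ℝ)⁻¹ * Real.exp (-δ)) (Real.exp δ)) ∘L
          (dualCutoffProj ∅ M ∘L (annulusProj p 1 ∘L scalingUnitary (m * Real.log p)))))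
          ((f i : evenPart) : Lp ℂ 2 (volume : Measure ℝ))⟫_ℂ‖ ≤ C) ∧
    (∀ (M : ℝ) (m : ℤ) (ι : Type) (f : HilbertBasis ι ℂ (evenPart : Submodule ℂ (Lp ℂ 2 (volume : Measure ℝ)))) (ι' : Type)
      (f' : HilbertBasis ι' ℂ (evenPart : Submodule ℂ (Lp ℂ 2 (volume : Measure ℝ)))),
      ∑' i, ⟪((f i : evenPart) : Lp ℂ 2 (volume : Measure ℝ)),
        (scalingOp g ∘L ((1 - shellProj ((p : ℝ)⁻¹ * Real.exp (-δ)) (Real.exp δ)) ∘L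
          (dualCutoffProj ∅ M ∘L (annulusProj p 1 ∘L scalingUnitary (m * Real.log p)))))
          ((f i : evenPart) : Lp ℂ 2 (volume : Measure ℝ))⟫_ℂ =
      ∑' i, ⟪((f' i : evenPart) : Lp ℂ 2 (volume : Measure ℝ)),
        (scalingOp g ∘L ((1 - shellProj ((p : ℝ)⁻¹ * Real.exp (-δ)) (Real.exp δ)) ∘L
          (dualCutoffProj ∅ M ∘L (annulusProj p 1 ∘L scalingUnitary (m * Real.log p)))))
          ((f' i : evenPart) : Lp ℂ 2 (volume : Measure ℝ))⟫_ℂ) ∧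
    (∀ (m : ℤ) (ι : Type) (f : HilbertBasis ι ℂ (evenPart : Submodule ℂ (Lp ℂ 2 (volume : Measure ℝ)))),
      Tendsto (fun M : ℝ => ∑' i, ⟪((f i : evenPart) : Lp ℂ 2 (volume : Measure ℝ)),
        (scalingOp g ∘L ((1 - shellProj ((p : ℝ)⁻¹ * Real.exp (-δ)) (Real.exp δ)) ∘L
          (dualCutoffProj ∅ M ∘L (annulusProj p 1 ∘L scalingUnitary (m * Real.log p)))))
          ((f i : evenPart) : Lp ℂ 2 (volume : Measure ℝ))⟫_ℂ) atTop (𝓝 0)) := by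
  haveI : CompleteSpace (evenPart : Submodule ℂ (Lp ℂ 2 (volume : Measure ℝ))) := completeSpace_evenPart
  have hgi : Integrable g := hg.1.continuous.integrable_of_hasCompactSupport hg.2
  obtain ⟨lam, σ, u₀, w₀, nu, nw, u, w, hσ, hu₀, hw₀, hu_ae, hw_ae, hnu, hnw, hsum, hexp⟩ :=
    exists_rankOne_expansion_separatedSinc p hδ
  -- abbreviations
  set T : ℝ → (Lp ℂ 2 (volume : Measure ℝ) →L[ℂ] Lp ℂ 2 (volume : Measure ℝ)) := fun M =>
    ((1 : Lp ℂ 2 (volume : Measure ℝ) →L[ℂ] Lp ℂ 2 (volume : Measure ℝ)) -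
        shellProj ((p : ℝ)⁻¹ * Real.exp (-δ)) (Real.exp δ)) ∘L
      (dualCutoffProj ∅ M ∘L shellProj (p : ℝ)⁻¹ 1) with hT
  have hQ0 : annulusProj p 1 = shellProj (p : ℝ)⁻¹ 1 := by rw [annulusProj_eq_shellProj, one_div]
  have hA : ∀ (M : ℝ) (m : ℤ) (x : Lp ℂ 2 (volume : Measure ℝ)),
      (scalingOp g ∘L ((1 - shellProj ((p : ℝ)⁻¹ * Real.exp (-δ)) (Real.exp δ)) ∘L
          (dualCutoffProj ∅ M ∘L (annulusProj p 1 ∘L scalingUnitary (m * Real.log p))))) x =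
      scalingOp g (T M (scalingUnitary (m * Real.log p) x)) := by
    intro M m x
    simp only [hT, hQ0, ContinuousLinearMap.comp_apply]
  have hA0 : ∀ (M : ℝ), M ≤ 0 → ∀ (m : ℤ) (x : Lp ℂ 2 (volume : Measure ℝ)),
      (scalingOp g ∘L ((1 - shellProj ((p : ℝ)⁻¹ * Real.exp (-δ)) (Real.exp δ)) ∘L
          (dualCutoffProj ∅ M ∘L (annulusProj p 1 ∘L scalingUnitary (m * Real.log p))))) x = 0 := by
    intro M hM m x
    simp only [ContinuousLinearMap.comp_apply, dualCutoffProj_empty_of_nonpos hM, zero_apply,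
      map_zero]
  -- the `M`-free nuclear norm
  have hsumM : ∀ M, Summable (fun k => ‖lam k‖ * (‖u M k‖ ^ 2 + ‖w M k‖ ^ 2)) := fun M => by
    simp only [hnu, hnw]; exact hsum
  set C₀ : ℝ := ∑' k, ‖lam k‖ * (nu k ^ 2 + nw k ^ 2) with hC₀
  have hC₀0 : 0 ≤ C₀ := tsum_nonneg fun k => by positivity
  have htsumM : ∀ M, ∑' k, ‖lam k‖ * (‖u M k‖ ^ 2 + ‖w M k‖ ^ 2) = C₀ := fun M => by
    simp only [hnu, hnw, hC₀]
  have hU1 : ∀ m : ℤ, ‖scalingUnitary (m * Real.log p)‖ ^ 2 ≤ 1 := fun m =>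
    pow_le_one₀ (norm_nonneg _) (norm_scalingUnitary_le_one _)
  -- the key consequence of the sandwich theorem, for `M > 0`
  have key : ∀ (M : ℝ), 0 < M → ∀ (m : ℤ) (ι : Type)
      (f : HilbertBasis ι ℂ (evenPart : Submodule ℂ (Lp ℂ 2 (volume : Measure ℝ)))),
      (Summable fun i => ‖⟪((f i : evenPart) : Lp ℂ 2 (volume : Measure ℝ)),
        scalingOp g (T M (scalingUnitary (m * Real.log p) ((f i : evenPart) : Lp ℂ 2 (volume : Measure ℝ))))⟫_ℂ‖) ∧
      ∑' i, ‖⟪((f i : evenPart) : Lp ℂ 2 (volume : Measure ℝ)),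
        scalingOp g (T M (scalingUnitary (m * Real.log p) ((f i : evenPart) : Lp ℂ 2 (volume : Measure ℝ))))⟫_ℂ‖ ≤
        (‖scalingOp g‖ ^ 2 + ‖scalingUnitary (m * Real.log p)‖ ^ 2) * ∑' k, ‖lam k‖ * (‖u M k‖ ^ 2 + ‖w M k‖ ^ 2) ∧
      ∑' i, ⟪((f i : evenPart) : Lp ℂ 2 (volume : Measure ℝ)),
        scalingOp g (T M (scalingUnitary (m * Real.log p) ((f i : evenPart) : Lp ℂ 2 (volume : Measure ℝ))))⟫_ℂ =
        ∑' k, lam k * ⟪ContinuousLinearMap.adjoint (scalingUnitary (m * Real.log p)) (w M k), (evenPart : Submodule ℂ (Lp ℂ 2 (volume : Measure ℝ))).starProjection (scalingOp g (u M k))⟫_ℂ :=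
    fun M hM m ι f => rankOne_sandwich_diag_coe f (hexp M hM) (hsumM M)
  refine ⟨(‖scalingOp g‖ ^ 2 + 1) * C₀, ?_, ?_, ?_⟩
  · -- (S1)
    intro M m ι f
    by_cases hM : 0 < M
    · obtain ⟨h1, h2, -⟩ := key M hM m ι f
      simp only [hA]
      refine ⟨h1, h2.trans ?_⟩
      rw [htsumM]
      have hX0 : 0 ≤ ‖scalingOp g‖ ^ 2 := sq_nonneg _
      nlinarith [hU1 m, hC₀0]
    · have hM' : M ≤ 0 := not_lt.mp hM
      simp only [hA0 M hM' m, inner_zero_right, norm_zero, tsum_zero]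
      exact ⟨summable_zero, by positivity⟩
  · -- (S0)
    intro M m ι f ι' f'
    by_cases hM : 0 < M
    · simp only [hA]
      rw [(key M hM m ι f).2.2, (key M hM m ι' f').2.2]
    · have hM' : M ≤ 0 := not_lt.mp hM
      simp only [hA0 M hM' m, inner_zero_right, tsum_zero]
  · -- (S2)
    intro m ι f
    have hterm : ∀ k, Tendsto (fun M : ℝ =>
        lam k * ⟪ContinuousLinearMap.adjoint (scalingUnitary (m * Real.log p)) (w M k), (evenPart : Submodule ℂ (Lp ℂ 2 (volume : Measure ℝ))).starProjection (scalingOp g (u M k))⟫_ℂ)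
        atTop (𝓝 0) := by
      intro k
      have h := tendsto_inner_adjoint_starProjection_scalingOp hgi (m * Real.log p) (hw₀ k) (hu₀ k) (hσ k)
        (fun M => hw_ae M k) (fun M => hu_ae M k)
      simpa only [mul_zero] using h.const_mul (lam k)
    have hbound : ∀ᶠ M : ℝ in atTop, ∀ k,
        ‖lam k * ⟪ContinuousLinearMap.adjoint (scalingUnitary (m * Real.log p)) (w M k), (evenPart : Submodule ℂ (Lp ℂ 2 (volume : Measure ℝ))).starProjection (scalingOp g (u M k))⟫_ℂ‖ ≤
          ‖scalingOp g‖ * (‖lam k‖ * (nu k ^ 2 + nw k ^ 2)) := by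
      refine Eventually.of_forall fun M k => ?_
      rw [norm_mul]
      have h1 : ‖ContinuousLinearMap.adjoint (scalingUnitary (m * Real.log p)) (w M k)‖ = nw k := by
        rw [adjoint_scalingUnitary, norm_scalingUnitary_apply, hnw]
      have h2 : ‖(evenPart : Submodule ℂ (Lp ℂ 2 (volume : Measure ℝ))).starProjection (scalingOp g (u M k))‖ ≤
          ‖scalingOp g‖ * nu k := by
        refine (Submodule.norm_starProjection_apply_le _ _).trans ?_
        rw [← hnu M k]; exact (scalingOp g).le_opNorm _
      have h3 : ‖⟪ContinuousLinearMap.adjoint (scalingUnitary (m * Real.log p)) (w M k), (evenPart : Submodule ℂ (Lp ℂ 2 (volume : Measure ℝ))).starProjection (scalingOp g (u M k))⟫_ℂ‖ ≤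
          nw k * (‖scalingOp g‖ * nu k) := by
        refine (norm_inner_le_norm _ _).trans ?_
        rw [h1]
        exact mul_le_mul_of_nonneg_left h2 (by rw [← hnw M k]; exact norm_nonneg _)
      have hnu0 : 0 ≤ nu k := by rw [← hnu M k]; exact norm_nonneg _
      have hnw0 : 0 ≤ nw k := by rw [← hnw M k]; exact norm_nonneg _
      have hX0 : 0 ≤ ‖scalingOp g‖ := norm_nonneg _
      have hl0 : 0 ≤ ‖lam k‖ := norm_nonneg _
      calc ‖lam k‖ * ‖⟪ContinuousLinearMap.adjoint (scalingUnitary (m * Real.log p)) (w M k), (evenPart : Submodule ℂ (Lp ℂ 2 (volume : Measure ℝ))).starProjection (scalingOp g (u M k))⟫_ℂ‖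
          ≤ ‖lam k‖ * (nw k * (‖scalingOp g‖ * nu k)) := mul_le_mul_of_nonneg_left h3 hl0
        _ ≤ ‖scalingOp g‖ * (‖lam k‖ * (nu k ^ 2 + nw k ^ 2)) := by
            nlinarith [sq_nonneg (nu k - nw k), mul_nonneg hX0 hl0, mul_nonneg (mul_nonneg hX0 hl0) (sq_nonneg (nu k - nw k))]
    have hV := tendsto_tsum_of_dominated_convergence (hsum.mul_left ‖scalingOp g‖) hterm hbound
    rw [tsum_zero] at hV
    refine hV.congr' ?_
    filter_upwards [eventually_gt_atTop (0 : ℝ)] with M hM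
    simp only [hA]
    exact (key M hM m ι f).2.2.symm

/-! ## §4. The semilocal trace formula at one prime -/

/-- **Connes 1999 Thm VII.4 (`k = ℚ`) at `S = {∞, p}` — a THEOREM.**  For every prime `p`, every Weil test
function `g` and every Hilbert basis `(b_i)` of `L²(ℝ)_ev`: the diagonal series of `ϑ(g) R_Λ^S`,
`R_Λ^S = P̂_Λ^S P_Λ` (`S = {∞, p}`), is summable for every `Λ > 0` and
`Σ_i ⟨b_i | ϑ(g) R_Λ^S | b_i⟩ = 2 g(0) log Λ + ∫′_ℝ + ∫′_{ℚ_p^*} g(|u|)/|1 − u| d^*u + o(1)` as `Λ → ∞` — the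
conclusion of the named fact `Connes1999_thm_VII_4_rat` at `P = {p}` (the archimedean theorem of seat
gm-t13 g4, the annulus road of seat gm-t13 g5, and the separated remainder (S1,S0,S2) above with `δ = 1`). [cite: Connes1999, §VII Thm 4 (arXiv p0013:L1); Connes2026Letter, §7.4 display (arXiv p0025:L16)] -/
theorem Connes1999_thm_VII_4_rat_singleton {g : ℝ → ℂ} (hg : IsWeilTest g) (ι : Type)
    (b : HilbertBasis ι ℂ (evenPart : Submodule ℂ (Lp ℂ 2 (volume : Measure ℝ)))) :
    (∀ Λ : ℝ, 0 < Λ →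
      Summable fun i => diagCoeff g (cutoffR {p} Λ) ((b i : evenPart) : Lp ℂ 2 (volume : Measure ℝ))) ∧
    Tendsto (fun Λ : ℝ =>
        (∑' i, diagCoeff g (cutoffR {p} Λ) ((b i : evenPart) : Lp ℂ 2 (volume : Measure ℝ)))
          - connesSemilocalGeometricSide {p} Λ g)
      atTop (𝓝 0) := by
  obtain ⟨C, hS1, hS0, hS2⟩ := separatedRemainder_bound_indep_tendsto p hg one_pos
  exact Connes1999_thm_VII_4_rat_singleton_of_separated p hg one_pos hS1 hS0 hS2 ι b

end Literature.NumberTheory.Connes2026
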